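import Summits.Ventures.CertifiedManyBodySolver.Downfold.EmeryShapeWindowClosureBand
import Summits.Ventures.CertifiedManyBodySolver.Downfold.EmeryFermiScalePointsBi2201M61VirtualCorners
import HarnessLib

/-!
# THE ONE-BAND FERMI-SURFACE SHAPE `t′/t` OF THE WHOLE TYPED 3BE BOX `emeryBoxBi2201M61MoreePPSrc (EmeryBoxesKSlicesN)` OVER ITS WHOLE FILLING BAND (two-ray rule + band window closure, §B.86 (k);
# router/EMERY-SHAPE-CORNERS.tsv «band» row)

Venture CertifiedManyBodySolver, cell `pub/hubbard-downfold` (stage S1; INFLATION-RULES-3to1-B §B.86 (k)), seat hubbard-downfold-mod-4 (technique B, g35); namespace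
`Summit.Ventures.CertifiedManyBodySolver.Downfold.Emery`. Everything PROVED (0 sorry). WHAT THIS IS NOT: a statement about Bi₂Sr₂CuO₆₊δ (M61; Morée PP source box) — the typed box is SCREENING-GRADE;
`U = 0` one-body kinematics of the σ model (rigid band); object E = the EXACT `t–t′` shape of the σ Fermi surface.

**For EVERY one-body row of the box AND EVERY filling of the band n_H ∈ [1.1440000000000001, 1.1760000000000002] (ν ∈ [103/250, 107/250]): n_H = 1.144 (ν = 107/250) … n_H = 1.176 (ν = 103/250), the one-band t′/t of the σ Fermi surface at that row's own Fermi energy lies in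
[-0.322, -0.2425]** (`bi2201M61Box_fsRatio_band`) — `fsRatio_fermiEnergyOf_mem_Icc_windowClosure_band` with the end-filling point brackets: lower window
[ε_F(V_lo; ν₁)⁻, ε_F(A_lo; ν₂)⁺] = [1.6287, 1.7346] (closure antitone), upper window [0, ε_F(V_hi; ν₂)⁺] = [0, 1.9091] (monotone), regime at ε_F(H; ν₂)⁺ = 2.1302. The per-filling windows of
`EmeryBoxesBi2201M61ShapeCorners` are nested inside (same certificates).

Sources: three-band model [HybertsenSchluterChristensen1989, Eq. (1)]; [AndersenEtAl1995, §6]; box rows as cited in the typed object's file.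
-/

noncomputable section

namespace Summit.Ventures.CertifiedManyBodySolver.Downfold.Emery

open Real Set

/-- **Bi₂Sr₂CuO₆₊δ (M61; Morée PP source box), filling band n_H ∈ [1.1440000000000001, 1.1760000000000002] (ν ∈ [103/250, 107/250]): n_H = 1.144 (ν = 107/250) … n_H = 1.176 (ν = 103/250): for every row of the box and every filling of the band, the one-band Fermi-surface `t′/t` (object E) lies in `[-0.322, -0.2425]`.** [folklore] -/
theorem bi2201M61Box_fsRatio_band {Δ a b c ν : ℝ} (hΔ : Δ ∈ Icc ((44 : ℝ) / 25) ((59 : ℝ) / 25)) (ha : a ∈ Icc ((5 : ℝ) / 4) ((147 : ℝ) / 100)) (hb : b ∈ Icc ((31 : ℝ) / 50) ((37 : ℝ) / 50)) (hc : c ∈ Icc ((7 : ℝ) / 50) ((17 : ℝ) / 100)) (hν : ν ∈ Icc ((103 : ℝ) / 250) ((107 : ℝ) / 250)) :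
    fsRatio Δ a b c (fermiEnergyOf Δ a b c ν) ∈ Icc ((-161 : ℝ) / 500) ((-97 : ℝ) / 400) := by
  have hV : ((17 : ℝ) / 100) * ((37 : ℝ) / 50) / ((31 : ℝ) / 50) = ((629 : ℝ) / 3100) := by norm_num
  have hW : ((7 : ℝ) / 50) * ((31 : ℝ) / 50) / ((37 : ℝ) / 50) = ((217 : ℝ) / 1850) := by norm_num
  have hVlo := (fermiEnergyOf_of_pointBracketCheck virtPt_Bi2201M61Vlo_nH1176_br (by norm_num) (by norm_num) (by norm_num) (ν := (103/250 : ℝ)) (by push_cast; exact ⟨le_rfl, le_rfl⟩)).2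
  have hVhi := (fermiEnergyOf_of_pointBracketCheck virtPt_Bi2201M61Vhi_nH1144_br (by norm_num) (by norm_num) (by norm_num) (ν := (107/250 : ℝ)) (by push_cast; exact ⟨le_rfl, le_rfl⟩)).2
  have hAlo := (fermiEnergyOf_of_pointBracketCheck virtPt_Bi2201M61Alo_nH1144_br (by norm_num) (by norm_num) (by norm_num) (ν := (107/250 : ℝ)) (by push_cast; exact ⟨le_rfl, le_rfl⟩)).2
  have hTop := (fermiEnergyOf_of_pointBracketCheck virtPt_Bi2201M61H_nH1144_br (by norm_num) (by norm_num) (by norm_num) (ν := (107/250 : ℝ)) (by push_cast; exact ⟨le_rfl, le_rfl⟩)).2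
  have hLo2 := (fermiEnergyOf_of_pointBracketCheck virtPt_Bi2201M61Vlo_nH1176_br (by norm_num) (by norm_num) (by norm_num) (ν := (103/250 : ℝ)) (by push_cast; exact ⟨le_rfl, le_rfl⟩)).2
  push_cast at hVlo hVhi hAlo hTop
  norm_num at hVlo hVhi hAlo hTop
  refine fsRatio_fermiEnergyOf_mem_Icc_windowClosure_band (Δ₁ := ((44 : ℝ) / 25)) (Δ₂ := ((59 : ℝ) / 25)) (a₁ := ((5 : ℝ) / 4)) (a₂ := ((147 : ℝ) / 100)) (b₁ := ((31 : ℝ) / 50))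
    (b₂ := ((37 : ℝ) / 50)) (c₁ := ((7 : ℝ) / 50)) (c₂ := ((17 : ℝ) / 100)) (e₁ := ((16287 : ℝ) / 10000)) (e₂ := ((8673 : ℝ) / 5000)) (e₃ := 0) (e₄ := ((19091 : ℝ) / 10000)) (ν₁ := ((103 : ℝ) / 250)) (ν₂ := ((107 : ℝ) / 250)) (by norm_num) (by norm_num) (by norm_num) (by norm_num)
    (by norm_num) hΔ ha hb hc (by norm_num) hν (by norm_num) ?_ ?_ ?_ (by norm_num) ?_ ?_ ?_ (by norm_num) ?_
  · nlinarith [hTop.2]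
  · rw [hV]; exact hVlo.1
  · exact hAlo.2
  · intro ε hε
    rw [hV]
    have hanti := (fsRatio_mem_Icc_on_window_of_dopingDisc_nonneg (Δ := ((44 : ℝ) / 25)) (a := ((5 : ℝ) / 4)) (b := ((37 : ℝ) / 50)) (c := ((629 : ℝ) / 3100))
      (p := ((16287 : ℝ) / 10000)) (q := ((8673 : ℝ) / 5000)) (by norm_num) (by norm_num) (by norm_num) (by norm_num) (by norm_num) (by norm_num) (by norm_num)
      (by norm_num [dopingDisc]) hε).1
    refine le_trans ?_ hanti
    norm_num [fsRatio, fsD, fsN]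
  · exact (fermiEnergyOf_pos (by norm_num) (by norm_num) (by norm_num) (by norm_num) (by norm_num) (by norm_num)).le
  · rw [hW]; exact hVhi.2
  · intro ε hε
    rw [hW]
    have hmono := (fsRatio_mem_Icc_on_window_of_dopingDisc_nonpos (Δ := ((59 : ℝ) / 25)) (a := ((147 : ℝ) / 100)) (b := ((31 : ℝ) / 50)) (c := ((217 : ℝ) / 1850))
      (p := 0) (q := ((19091 : ℝ) / 10000)) (by norm_num) (by norm_num) (by norm_num) (by norm_num) (by norm_num) (by norm_num) (by norm_num)
      (by norm_num [dopingDisc]) hε).2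
    refine le_trans hmono ?_
    norm_num [fsRatio, fsD, fsN]

end Summit.Ventures.CertifiedManyBodySolver.Downfold.Emery
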